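import Summits.Ventures.LatticeQCDFlow.Scaling.ExtensiveSpecificHeatStaple

/-!
HONEST FRAMING: exact (Metropolis-corrected) sampling algorithms for lattice gauge theory; figures
of merit are autocorrelation/cost numbers at stated couplings and volumes; no continuum-physics
claim.

# Extensive variance floor for the Wilson action — every compact gauge group, every coupling

THEORY-2 item 126 (theory2 GEN-39; cell pub-lqcd / Ventures/LatticeQCDFlow), PART 4 of 4 (§7, the assembly).
CUSTODY: theory2 item 126 (GEN-39, HOME tier) re-landed by lean-2 GEN-9 per LEAD LINE 245 RT-30 (202);
statements and proofs = HOME/lean/theory2/ExtensiveSpecificHeat.lean 21be0330075c0491 (1 051 l) verbatim,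
split below the `lint.size` line into FOUR files (`…HeatBath` §1–§2, `…Innovations` §3–§4, `…Staple`
§5–§6, `ExtensiveSpecificHeat` §7); headers trimmed; landing edits: docstrings added where the lint asks.


**Main theorem** (`wilson_variance_ge_extensive`). On the torus `(ℤ/L)^{n+2}`, `L ≥ 2`, for every
compact second-countable Hausdorff-Borel group `G`, every continuous representation
`ρ : G →* Matrix (Fin N) (Fin N) ℂ` and EVERY real `β`,

  `L·⌊L/2⌋^{n+1} · exp(−8N(n+1)|β|) · Var_Haar(Re tr ρ) ≤ Var_{π_β}(S_W)`,

where `π_β ∝ exp(−β S_W) dHaar` is the Wilson measure (`wilsonMeasure ρ β`) and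
`S_W = ∑_p (N − Re tr ρ(U_p))` (`wilsonAction ρ`).  Corollary
`wilson_variance_ge_extensive_window`: the same with `exp(−8N(n+1)B)` uniformly on `|β| ≤ B`.

So the specific heat per plaquette `Var(S_W)/#plaq` is bounded BELOW by the explicit positive
constant `2·exp(−8N(d−1)B)·Var_Haar(Re tr ρ)/((d choose 2)·2^d)` on every coupling window, for every
gauge group — the input `(SH_W)`-on-a-window of the exact-reweighting / annealing cost laws
(`ReweightingStepLawAnyGroup`, `AnnealingAnyGroup`: one exact step `β → β+δ` costs
`≥ exp(δ² · min Var)` second moment, a `k`-step schedule `≥ (Δβ)² · min Var / k`), previously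
available only on the Kotecký–Preiss strong-coupling window (`SpecificHeatAnyGroup`) or for `U(1)`.

**Proof** (Dobrushin–Tirozzi sublattice conditioning, no expansion):
* §1–§3: for a link `e`, the heat-bath kernel `K_e` (conditional expectation given the other links)
  and the innovation `D_e = S_W − K_e S_W`; innovations of links with DISJOINT plaquette sets are
  `π_β`-orthogonal and orthogonal to functions not depending on the link, hence
  `∑_{e ∈ M} ∫ D_e² dπ_β ≤ Var_{π_β}(S_W)` for any such family `M` (`sum_integral_innov_sq_le`).
* §4: `∫ D_e² dπ_β ≥ exp(−2|β|N·#plaq(e)) · exp(−2|β|N·#plaq(e*)) · ∫ A_{e*} Q_e dπ_β`, where `Q_e` is the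
  fibre variance of `S_W` under HAAR resampling of `e` and `A_{e*}` the Haar average over a second
  link (`integral_innov_sq_ge`; two uses of the one-link density sandwich
  `lintegral_oneLink_le_wilsonMeasure`).
* §5–§7: the STAPLE FLOOR `A_{(x+e₀,1)} Q_{(x,0)} (U) ≥ Var_Haar(Re tr ρ)` for EVERY configuration `U`
  (`haarVar_le_linkAvg_sqDev`): along the two-link fibre `(h, g)`,
  `S_W(h ·_{(x,0)} g ·_{(x+e₀,1)} U) = A(h) − Re tr ρ(h · a g b) + c(g)` (`a = U(x,0)`), and for such
  `T` one has `∫∫ (T − ∫T dh)² ≥ ∫ (φ − ∫φ)²` by expanding the square, Fubini and the translation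
  invariance of Haar (`staple_decoupling`).  §6 supplies the even family `M = {(x,0) : x_j even, j ≥ 1}`
  (`|M| = L⌊L/2⌋^{n+1}`, pairwise disjoint plaquette sets) and the staple geometry on the torus.

Provenance: written and checked (farm `lean check`, rc 0, 0 sorries, axioms `propext`,
`Classical.choice`, `Quot.sound`) by theory2 GEN-39, 2026-08-22; imports only tree modules.
-/


noncomputable section

set_option linter.unusedSectionVars false

namespace Summit.Ventures.LatticeQCDFlow.Theory2.ExtensiveSpecificHeat

open MeasureTheory ProbabilityTheory Literature.MathematicalPhysics.QuantumFieldTheory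
open Summit.Ventures.LatticeQCDFlow.TrivializingMaps
open scoped ENNReal

/-! ## §7 The staple floor and the extensive variance floor -/

section Main

variable {n L N : ℕ} [NeZero L] {G : Type*} [Group G] [TopologicalSpace G] [IsTopologicalGroup G]
  [CompactSpace G] [MeasurableSpace G] [BorelSpace G] [SecondCountableTopology G]
  [DecidableEq (Edge (n + 2) L)] (ρ : G →* Matrix (Fin N) (Fin N) ℂ)

/-- The `h`-dependent, `g`-independent part of `S(h ·ₑ g ·ₑ' U)` (`e = (x,0)`, `e' = (x+e₀,1)`):
minus the change, under `h`, of the plaquettes through `e` other than `p₀ = (x; 0, 1)`. -/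
def stapleRest (x : Site (n + 2) L) (U : GaugeConfig (n + 2) L G) (h : G) : ℝ :=
  ∑ p ∈ (plaqsThrough ((x, 0) : Edge (n + 2) L)).erase (basePlaq x),
    (WilsonRP.plaqRe ρ U p - WilsonRP.plaqRe ρ (Pi.mulSingle ((x, 0) : Edge (n + 2) L) h * U) p)

/-- The `g`-dependent, `h`-independent part of `S(h ·ₑ g ·ₑ' U)`. -/
def stapleConst (x : Site (n + 2) L) (U : GaugeConfig (n + 2) L G) (g : G) : ℝ :=
  wilsonAction ρ (Pi.mulSingle ((x.shift 0, 1) : Edge (n + 2) L) g * U)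
    + WilsonRP.plaqRe ρ (Pi.mulSingle ((x.shift 0, 1) : Edge (n + 2) L) g * U) (basePlaq x)

/-- **STAPLE FLOOR (pointwise in the environment).** For every configuration `U` and every site
`x`: the Haar average over the staple link `(x + e₀, 1)` of the fibre variance of the action along
the link `(x, 0)` is at least `Var_Haar(Re tr ρ)`. -/
theorem haarVar_le_linkAvg_sqDev (hL : 2 ≤ L) (hρ : Continuous ρ) (x : Site (n + 2) L)
    (U : GaugeConfig (n + 2) L G) :
    ∫ g, ((ρ g).trace.re - ∫ g', (ρ g').trace.re ∂haarProbability G) ^ 2 ∂haarProbability G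
      ≤ linkAvg ((x.shift 0, 1) : Edge (n + 2) L) (sqDev ρ ((x, 0) : Edge (n + 2) L)) U := by
  have h01 : (0 : Fin (n + 2)) ≠ 1 := Fin.zero_lt_one.ne
  have hne : ((x, 0) : Edge (n + 2) L) ≠ (x.shift 0, 1) := fun h => h01 (congrArg Prod.snd h)
  have hp0 : basePlaq x ∈ plaqsThrough ((x, 0) : Edge (n + 2) L) := basePlaq_mem_plaqsThrough (L := L) x
  have hφ : Continuous fun m : G => (ρ m).trace.re :=
    Complex.continuous_re.comp hρ.matrix_trace
  -- the `h`-only part is continuous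
  have hA : Continuous (stapleRest ρ x U) := by
    unfold stapleRest
    refine continuous_finsetSum _ fun p _ => continuous_const.sub ?_
    simp only [WilsonRP.plaqRe]
    refine Complex.continuous_re.comp (hρ.comp ?_).matrix_trace
    simp only [plaquetteHolonomy]
    have hev : ∀ e' : Edge (n + 2) L, Continuous fun h : G =>
        (Pi.mulSingle ((x, 0) : Edge (n + 2) L) h * U : GaugeConfig (n + 2) L G) e' := fun e' =>
      (continuous_apply e').comp (continuous_mulSingle_mul ((x, 0) : Edge (n + 2) L) U)
    exact (((hev _).mul (hev _)).mul (hev _).inv).mul (hev _).inv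
  -- the additive decomposition `S(h ·ₑ g ·ₑ' U) = A(h) − Re tr ρ(h · a g b) + c(g)`
  have hT : ∀ h g : G,
      wilsonAction ρ (Pi.mulSingle ((x, 0) : Edge (n + 2) L) h
        * (Pi.mulSingle ((x.shift 0, 1) : Edge (n + 2) L) g * U))
      = stapleRest ρ x U h
        - (ρ (h * (U (x, 0) * g * ((U (x, 0))⁻¹ * plaquetteHolonomy U x 0 1)))).trace.re
        + stapleConst ρ x U g := by
    intro h g
    have hsub := WitnessColumn.wilsonAction_mulSingle_sub_eq ρ ((x, 0) : Edge (n + 2) L) h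
      (Pi.mulSingle ((x.shift 0, 1) : Edge (n + 2) L) g * U)
    rw [← Finset.add_sum_erase _ _ hp0] at hsub
    have hA' : ∑ p ∈ (plaqsThrough ((x, 0) : Edge (n + 2) L)).erase (basePlaq x),
          (WilsonRP.plaqRe ρ (Pi.mulSingle ((x.shift 0, 1) : Edge (n + 2) L) g * U) p
            - WilsonRP.plaqRe ρ (Pi.mulSingle ((x, 0) : Edge (n + 2) L) h
                * (Pi.mulSingle ((x.shift 0, 1) : Edge (n + 2) L) g * U)) p)
        = stapleRest ρ x U h := by
      unfold stapleRest
      refine Finset.sum_congr rfl fun p hp => ?_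
      obtain ⟨hpne, hpmem⟩ := Finset.mem_erase.1 hp
      have hns := not_mem_plaqsThrough_staple hL x hpmem hpne
      rw [WitnessColumn.plaqRe_mulSingle_of_not_mem ρ hns, mulSingle_comm_mul hne,
        WitnessColumn.plaqRe_mulSingle_of_not_mem ρ hns]
    have hP : WilsonRP.plaqRe ρ (Pi.mulSingle ((x, 0) : Edge (n + 2) L) h
          * (Pi.mulSingle ((x.shift 0, 1) : Edge (n + 2) L) g * U)) (basePlaq x)
        = (ρ (h * (U (x, 0) * g * ((U (x, 0))⁻¹ * plaquetteHolonomy U x 0 1)))).trace.re := by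
      simp only [WilsonRP.plaqRe, basePlaq]
      rw [plaquetteHolonomy_mulSingle_left hL _ x h01 h,
        plaquetteHolonomy_mulSingle_second hL U x h01 g, mul_assoc (U (x, 0) * g)]
    rw [hA', hP] at hsub
    unfold stapleConst
    linarith [hsub]
  have key := staple_decoupling hA hφ (U (x, 0)) ((U (x, 0))⁻¹ * plaquetteHolonomy U x 0 1) hT
  unfold linkAvg sqDev fibreMean
  unfold linkAvg
  exact key

/-- **PER-LINK FLOOR.** `e^{−8N(n+1)|β|} · Var_Haar(Re tr ρ) ≤ ∫ D_{(x,0)}² dπ_β` for every site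
`x` of the torus of dimension `n + 2`. -/
theorem integral_innov_sq_ge_haarVar (hL : 2 ≤ L) (hρ : Continuous ρ) (β : ℝ)
    (x : Site (n + 2) L) :
    Real.exp (-(8 * N * (n + 1) * |β|))
        * ∫ g, ((ρ g).trace.re - ∫ g', (ρ g').trace.re ∂haarProbability G) ^ 2 ∂haarProbability G
      ≤ ∫ U, (innov ρ β ((x, 0) : Edge (n + 2) L) U) ^ 2 ∂wilsonMeasure ρ β := by
  haveI := isProbabilityMeasure_wilsonMeasure (d := n + 2) (L := L) ρ hρ β
  have hv0 : 0 ≤ ∫ g, ((ρ g).trace.re - ∫ g', (ρ g').trace.re ∂haarProbability G) ^ 2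
      ∂haarProbability G := integral_nonneg fun _ => sq_nonneg _
  -- the staple floor, integrated over `π_β`
  have hQ : Continuous (linkAvg ((x.shift 0, 1) : Edge (n + 2) L)
      (sqDev ρ ((x, 0) : Edge (n + 2) L))) := continuous_linkAvg _ (continuous_sqDev ρ hρ _)
  have hI : ∫ g, ((ρ g).trace.re - ∫ g', (ρ g').trace.re ∂haarProbability G) ^ 2 ∂haarProbability G
      ≤ ∫ U, linkAvg ((x.shift 0, 1) : Edge (n + 2) L) (sqDev ρ ((x, 0) : Edge (n + 2) L)) U
          ∂wilsonMeasure ρ β := by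
    have h := integral_mono (μ := wilsonMeasure (d := n + 2) (L := L) ρ β) (integrable_const _)
      (integrable_of_continuous_config hQ) fun U => haarVar_le_linkAvg_sqDev ρ hL hρ x U
    rwa [integral_const, smul_eq_mul, probReal_univ, one_mul] at h
  -- the two ENGINE constants
  have hcard : ∀ e : Edge (n + 2) L, ((plaqsThrough e).card : ℝ) ≤ 2 * ((n : ℝ) + 1) := by
    intro e
    have h := card_plaqsThrough_le e
    have h' : (plaqsThrough e).card ≤ 2 * (n + 1) := by omega
    exact_mod_cast h'
  have hc : ∀ e : Edge (n + 2) L, Real.exp (-(4 * N * (n + 1) * |β|))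
      ≤ Real.exp (-(2 * |β| * N * ((plaqsThrough e).card : ℝ))) := by
    intro e
    apply Real.exp_le_exp.2
    have h := mul_le_mul_of_nonneg_left (hcard e)
      (mul_nonneg (mul_nonneg (by norm_num : (0 : ℝ) ≤ 2) (abs_nonneg β)) (Nat.cast_nonneg N))
    linarith
  have hmain := integral_innov_sq_ge ρ hρ β ((x, 0) : Edge (n + 2) L)
    ((x.shift 0, 1) : Edge (n + 2) L)
  have hsplit : Real.exp (-(8 * N * (n + 1) * |β|))
      = Real.exp (-(4 * N * (n + 1) * |β|)) * Real.exp (-(4 * N * (n + 1) * |β|)) := by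
    rw [← Real.exp_add]; ring_nf
  calc Real.exp (-(8 * N * (n + 1) * |β|))
        * ∫ g, ((ρ g).trace.re - ∫ g', (ρ g').trace.re ∂haarProbability G) ^ 2 ∂haarProbability G
      = Real.exp (-(4 * N * (n + 1) * |β|)) * (Real.exp (-(4 * N * (n + 1) * |β|))
          * ∫ g, ((ρ g).trace.re - ∫ g', (ρ g').trace.re ∂haarProbability G) ^ 2
              ∂haarProbability G) := by rw [hsplit, mul_assoc]
    _ ≤ Real.exp (-(2 * |β| * N * ((plaqsThrough ((x, 0) : Edge (n + 2) L)).card : ℝ)))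
          * (Real.exp (-(2 * |β| * N * ((plaqsThrough ((x.shift 0, 1) : Edge (n + 2) L)).card : ℝ)))
            * ∫ U, linkAvg ((x.shift 0, 1) : Edge (n + 2) L)
                (sqDev ρ ((x, 0) : Edge (n + 2) L)) U ∂wilsonMeasure ρ β) :=
        mul_le_mul (hc _) (mul_le_mul (hc _) hI hv0 (Real.exp_pos _).le)
          (mul_nonneg (Real.exp_pos _).le hv0) (Real.exp_pos _).le
    _ ≤ ∫ U, (innov ρ β ((x, 0) : Edge (n + 2) L) U) ^ 2 ∂wilsonMeasure ρ β := hmain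

/-- **THEOREM (extensive variance floor for the Wilson action, every compact gauge group).**
On the torus `(ℤ/L)^{n+2}`, `L ≥ 2`, for every continuous unitary-matrix representation `ρ` of a
compact second-countable group `G` and EVERY real `β`:
`L·⌊L/2⌋^{n+1} · e^{−8N(n+1)|β|} · Var_Haar(Re tr ρ) ≤ Var_{π_β}(S_W)`. -/
theorem wilson_variance_ge_extensive (hL : 2 ≤ L) (hρ : Continuous ρ) (β : ℝ) :
    ((L * (L / 2) ^ (n + 1) : ℕ) : ℝ) * Real.exp (-(8 * N * (n + 1) * |β|))
        * variance (fun g : G => (ρ g).trace.re) (haarProbability G)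
      ≤ variance (wilsonAction ρ) (wilsonMeasure (d := n + 2) (L := L) ρ β) := by
  classical
  haveI := isProbabilityMeasure_wilsonMeasure (d := n + 2) (L := L) ρ hρ β
  have hφ : Continuous fun m : G => (ρ m).trace.re := Complex.continuous_re.comp hρ.matrix_trace
  have hS : Continuous (wilsonAction (d := n + 2) (L := L) (G := G) ρ) :=
    continuous_wilsonAction' ρ hρ
  let emb : Site (n + 2) L ↪ Edge (n + 2) L := ⟨fun x => (x, 0), fun x y h => congrArg Prod.fst h⟩
  have hdis : ∀ e ∈ (evenSites n L).map emb, ∀ e' ∈ (evenSites n L).map emb, e ≠ e' →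
      Disjoint (plaqsThrough e) (plaqsThrough e') := by
    intro e he e' he' hne
    obtain ⟨x, hx, rfl⟩ := Finset.mem_map.1 he
    obtain ⟨x', hx', rfl⟩ := Finset.mem_map.1 he'
    have hxx : x ≠ x' := fun h => hne (by rw [h])
    exact disjoint_plaqsThrough_dir0 hx hx' hxx
  have hM := sum_integral_innov_sq_le ρ hρ β ((evenSites n L).map emb) hdis
    (∫ U, wilsonAction ρ U ∂wilsonMeasure (d := n + 2) (L := L) ρ β)
  rw [Finset.sum_map] at hM
  have hfl : ∀ x ∈ evenSites n L, Real.exp (-(8 * N * (n + 1) * |β|))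
      * ∫ g, ((ρ g).trace.re - ∫ g', (ρ g').trace.re ∂haarProbability G) ^ 2 ∂haarProbability G
      ≤ ∫ U, (innov ρ β (emb x) U) ^ 2 ∂wilsonMeasure ρ β := fun x _ =>
    integral_innov_sq_ge_haarVar ρ hL hρ β x
  calc ((L * (L / 2) ^ (n + 1) : ℕ) : ℝ) * Real.exp (-(8 * N * (n + 1) * |β|))
        * variance (fun g : G => (ρ g).trace.re) (haarProbability G)
      = ∑ x ∈ evenSites n L, Real.exp (-(8 * N * (n + 1) * |β|))
          * ∫ g, ((ρ g).trace.re - ∫ g', (ρ g').trace.re ∂haarProbability G) ^ 2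
              ∂haarProbability G := by
        rw [Finset.sum_const, nsmul_eq_mul, card_evenSites, variance_eq_integral hφ.aemeasurable,
          mul_assoc]
    _ ≤ ∑ x ∈ evenSites n L, ∫ U, (innov ρ β (emb x) U) ^ 2 ∂wilsonMeasure ρ β :=
        Finset.sum_le_sum hfl
    _ ≤ ∫ U, (wilsonAction ρ U - ∫ U, wilsonAction ρ U ∂wilsonMeasure (d := n + 2) (L := L) ρ β) ^ 2
          ∂wilsonMeasure (d := n + 2) (L := L) ρ β := hM
    _ = variance (wilsonAction ρ) (wilsonMeasure (d := n + 2) (L := L) ρ β) := by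
        rw [variance_eq_integral hS.aemeasurable]

/-- **COROLLARY (uniform on every bounded coupling window).** For every `B` and every real `β`
with `|β| ≤ B`: `L·⌊L/2⌋^{n+1} · e^{−8N(n+1)B} · Var_Haar(Re tr ρ) ≤ Var_{π_β}(S_W)` — an extensive
floor, uniform on `[−B, B]`, for every compact gauge group (no cluster expansion, no small-`β`
hypothesis). -/
theorem wilson_variance_ge_extensive_window (hL : 2 ≤ L) (hρ : Continuous ρ) {B β : ℝ}
    (hβ : |β| ≤ B) :
    ((L * (L / 2) ^ (n + 1) : ℕ) : ℝ) * Real.exp (-(8 * N * (n + 1) * B))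
        * variance (fun g : G => (ρ g).trace.re) (haarProbability G)
      ≤ variance (wilsonAction ρ) (wilsonMeasure (d := n + 2) (L := L) ρ β) := by
  refine le_trans ?_ (wilson_variance_ge_extensive ρ hL hρ β)
  have hv : 0 ≤ variance (fun g : G => (ρ g).trace.re) (haarProbability G) :=
    variance_nonneg _ _
  have hX : (0 : ℝ) ≤ ((L * (L / 2) ^ (n + 1) : ℕ) : ℝ) := Nat.cast_nonneg _
  have hexp : Real.exp (-(8 * N * (n + 1) * B)) ≤ Real.exp (-(8 * N * (n + 1) * |β|)) := by
    apply Real.exp_le_exp.2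
    have h8 : (0 : ℝ) ≤ 8 * N * (n + 1) := by positivity
    nlinarith [mul_le_mul_of_nonneg_left hβ h8]
  exact mul_le_mul_of_nonneg_right (mul_le_mul_of_nonneg_left hexp hX) hv

end Main

end Summit.Ventures.LatticeQCDFlow.Theory2.ExtensiveSpecificHeat
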